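import Mathlib.LinearAlgebra.Matrix.Determinant.Basic
import Mathlib.Analysis.SpecialFunctions.Complex.Arg
import Mathlib.Algebra.Polynomial.AlgebraMap
import Literature.Analysis.TotalPositivity.PolyaFrequency
import Literature.Analysis.TotalPositivity.PolyaFrequencyClosure
import HarnessLib

/-!
# Multiply positive (`PF_m`) sequences and Schoenberg's sector theorem — definition + named fact

Trunk T-ANALYSIS (Literature/Analysis/TotalPositivity). Leaf L1 of the decomposition of
`Literature.NumberTheory.LFunctions.katkova_pf44` (Katkova 2006, Thm. 1: `ξ₁ ∈ PF₄₄`), see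
`Literature/NumberTheory/LFunctions/XiMultiplePositivity.lean`.

* `IsMultiplyPositiveSeq m a` — a one-sided real sequence `(a_n)_{n ≥ 0}` (extended by `0`) is
  *`m`-times positive* (`PF_m`; Fekete 1912, Schoenberg 1955): every minor of ORDER `≤ m` of the
  Toeplitz matrix `(a_{i-j})_{i,j ≥ 0}` is `≥ 0` [Katkova 2006, Def. 2 — printed for the transposed
  matrix `(a_{j-i})`, which has the same set of minors; Karlin 1968, Ch. 8, §1]. Minors are the
  `toeplitzMinor a r c` of `PolyaFrequency.lean` (rows `r`, columns `c` strictly increasing), so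
  that `IsPolyaFrequencySeq a ↔ ∀ m, IsMultiplyPositiveSeq m a` (`isPolyaFrequencySeq_iff_forall`,
  Katkova: `PF_∞ = ∩ₘ PF_m`).
* API (proved): monotonicity in `m`, `PF_0` is trivial, `PF_1 =` non-negativity, scaling by
  `C ≥ 0`, closure under termwise limits (minors are continuous), PF `⇒ PF_m`.
* `schoenberg_sector_pf` — NAMED FACT, **Schoenberg's sector theorem** [Schoenberg 1955
  (Palermo note); quoted as Katkova 2006, §1, Thm. B and as Adm–Tyaglov, JMAA 2018
  (arXiv:1711.04651), Thm. 5.8]: a real polynomial `f` with `f(0) > 0` and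
  `f(z) ≠ 0` on the open sector `|arg z| < πm/(m+1)` has an `m`-times positive coefficient
  sequence. (Printed proof: factor `f = f(0) ∏(1 + αᵢz) ∏(1 + 2ρⱼ cos φⱼ z + ρⱼ² z²)` with
  `αᵢ ≥ 0`, `0 ≤ φⱼ ≤ π/(m+1)`; `(1, 2cos φ, 1) ∈ PF_m` iff `φ ≤ π/(m+1)`; `PF_m` is closed under
  convolution by the Cauchy–Binet formula.) Both constants are sharp (Katkova, loc. cit.).

Nothing is asserted by the named fact; users take `(h : schoenberg_sector_pf)`.

## References

* I. J. Schoenberg, *A note on multiply positive sequences and the Descartes rule of signs*,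
  Rend. Circ. Mat. Palermo (2) 4 (1955) 123–131. [Schoenberg1955]
* O. M. Katkova, *Multiple positivity and the Riemann zeta-function*, CMFT 7 (2007) 13–31;
  arXiv:math/0505174, §1 (Def. 2, Thms. A, B). [Katkova2006]
* S. Karlin, *Total Positivity I*, Stanford UP 1968, Ch. 8, §1. [Karlin1968]
* M. Fekete, G. Pólya, *Über ein Problem von Laguerre*, Rend. Circ. Mat. Palermo 34 (1912) 89–120.
-/

noncomputable section

open scoped Topology
open Filter Polynomial

namespace Literature.Analysis.TotalPositivity

/-! ### `m`-times positive sequences -/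

/-- **`m`-times positive (`PF_m`) sequence** (Fekete 1912; Schoenberg 1955): all minors of
order `≤ m` of the Toeplitz matrix `(a_{i-j})_{i,j ≥ 0}` (`a_n = 0` for `n < 0`) are non-negative.
Katkova's Def. 2 is stated for the transposed matrix `(a_{j-i})`, whose minors are the same
numbers (transpose the row/column selections). [Katkova 2006, Def. 2; Karlin 1968, Ch. 8, §1]
[cite: Katkova2006, §1 Def. 2] -/
def IsMultiplyPositiveSeq (m : ℕ) (a : ℕ → ℝ) : Prop :=
  ∀ (k : ℕ), k ≤ m → ∀ (r c : Fin k → ℕ), StrictMono r → StrictMono c → 0 ≤ toeplitzMinor a r c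

/-- `PF_m ⊇ PF_{m'}` for `m ≤ m'`. [Katkova 2006, §1 (`PF_∞ = ∩ PF_m`)] [folklore] -/
theorem IsMultiplyPositiveSeq.mono {m m' : ℕ} {a : ℕ → ℝ} (h : IsMultiplyPositiveSeq m' a)
    (hm : m ≤ m') : IsMultiplyPositiveSeq m a :=
  fun k hk r c hr hc => h k (hk.trans hm) r c hr hc

/-- `PF_0` is no condition: the only minor of order `0` is the empty determinant `1`. [folklore] -/
theorem isMultiplyPositiveSeq_zero (a : ℕ → ℝ) : IsMultiplyPositiveSeq 0 a := by
  intro k hk r c _ _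
  obtain rfl : k = 0 := Nat.le_zero.1 hk
  simp [toeplitzMinor, Matrix.det_isEmpty]

/-- A Pólya frequency sequence is `m`-times positive for every `m`. [Katkova 2006, §1] [folklore] -/
theorem IsPolyaFrequencySeq.isMultiplyPositiveSeq {a : ℕ → ℝ} (h : IsPolyaFrequencySeq a) (m : ℕ) :
    IsMultiplyPositiveSeq m a :=
  fun k _ r c hr hc => h k r c hr hc

/-- `PF_∞ = ∩ₘ PF_m` [Katkova 2006, §1: "Since `PF_∞ = ∩_{m=1}^∞ PF_m` …"]. [folklore] -/
theorem isPolyaFrequencySeq_iff_forall {a : ℕ → ℝ} :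
    IsPolyaFrequencySeq a ↔ ∀ m : ℕ, IsMultiplyPositiveSeq m a :=
  ⟨fun h m => h.isMultiplyPositiveSeq m, fun h k r c hr hc => h k k le_rfl r c hr hc⟩

/-- The `1 × 1` minors are the terms: an `m`-times positive sequence with `m ≥ 1` is termwise
`≥ 0`. [Karlin 1968, Ch. 8, §1] [folklore] -/
theorem IsMultiplyPositiveSeq.nonneg {m : ℕ} {a : ℕ → ℝ} (h : IsMultiplyPositiveSeq m a)
    (hm : 1 ≤ m) (n : ℕ) : 0 ≤ a n := by
  have := h 1 hm (fun _ => n) (fun _ => 0)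
    (fun i j hij => absurd hij (by simp [Fin.eq_zero i, Fin.eq_zero j]))
    (fun i j hij => absurd hij (by simp [Fin.eq_zero i, Fin.eq_zero j]))
  simpa [toeplitzMinor, Matrix.det_unique] using this

/-- `PF_1` is exactly termwise non-negativity. [Karlin 1968, Ch. 8, §1] [folklore] -/
theorem isMultiplyPositiveSeq_one_iff {a : ℕ → ℝ} :
    IsMultiplyPositiveSeq 1 a ↔ ∀ n, 0 ≤ a n := by
  refine ⟨fun h n => h.nonneg le_rfl n, fun h k hk r c _ _ => ?_⟩
  rcases Nat.le_one_iff_eq_zero_or_eq_one.1 hk with rfl | rfl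
  · simp [toeplitzMinor, Matrix.det_isEmpty]
  · rw [toeplitzMinor, Matrix.det_unique]
    simp only [Matrix.of_apply]
    unfold seqZ
    split_ifs
    · exact h _
    · exact le_rfl

/-- `PF_m` is closed under multiplication by a constant `C ≥ 0` (an order-`k` minor scales by
`C^k`). [Karlin 1968, Ch. 8, §1] [folklore] -/
theorem IsMultiplyPositiveSeq.smul {m : ℕ} {a : ℕ → ℝ} (h : IsMultiplyPositiveSeq m a) {C : ℝ}
    (hC : 0 ≤ C) : IsMultiplyPositiveSeq m (fun n => C * a n) := by
  intro k hk r c hr hc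
  rw [toeplitzMinor_const_mul]
  exact mul_nonneg (pow_nonneg hC _) (h k hk r c hr hc)

/-- **`PF_m` is closed under termwise limits** (minors are continuous in the sequence); this is
the limit step of Katkova's proof of Thm. 1 (`P_N → ξ₁` locally uniformly, so coefficientwise).
[Katkova 2006, proof of Thm. 1; Karlin 1968, Ch. 8, §1] [folklore] -/
theorem IsMultiplyPositiveSeq.of_tendsto {m : ℕ} {ι : Type*} {l : Filter ι} [l.NeBot]
    {a : ι → ℕ → ℝ} {b : ℕ → ℝ} (h : ∀ i, IsMultiplyPositiveSeq m (a i))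
    (hlim : ∀ n, Tendsto (fun i => a i n) l (𝓝 (b n))) : IsMultiplyPositiveSeq m b := by
  intro k hk r c hr hc
  have hpi : Tendsto a l (𝓝 b) := tendsto_pi_nhds.2 hlim
  have := ((continuous_toeplitzMinor r c).tendsto b).comp hpi
  exact ge_of_tendsto' this fun i => h i k hk r c hr hc

/-- The unit sequence `(1, 0, 0, …)` is `m`-times positive for every `m` (non-vacuity).
[folklore] -/
theorem isMultiplyPositiveSeq_delta (m : ℕ) :
    IsMultiplyPositiveSeq m (fun k => if k = 0 then (1 : ℝ) else 0) :=
  isPolyaFrequencySeq_delta.isMultiplyPositiveSeq m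

/-! ### Schoenberg's sector theorem (named fact) -/

/-- NAMED FACT (**Schoenberg 1955** (Palermo note), as quoted in **Katkova 2006, §1, Thm. B**:
"Let `f` be a polynomial, `f(0) > 0`. Then `f(z) ≠ 0` for `z ∈ {z : |arg z| < πm/(m+1)}`
`⟹ f ∈ PF_m`"; also Adm–Tyaglov 2018, Thm. 5.8, in the equivalent form "all zeros in
`π - π/(m+1) ≤ arg u ≤ π + π/(m+1)`"). Here `f` is a real polynomial (the classes `PF_m` consist
of real sequences), evaluated at complex `z` via `Polynomial.aeval`, `arg ∈ (-π, π]` is Mathlib's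
`Complex.arg` (so `z = 0`, with `arg 0 = 0`, lies in the open sector, harmlessly since `f(0) > 0`),
and the conclusion is that the coefficient sequence `(f.coeff n)_{n ≥ 0}` is `m`-times positive.
The constant `πm/(m+1)` is sharp. Users take `(h : schoenberg_sector_pf)`.
[cite: Katkova2006, §1 Thm. B] -/
def schoenberg_sector_pf : Prop :=
  ∀ (m : ℕ) (f : ℝ[X]), 0 < f.coeff 0 →
    (∀ z : ℂ, |z.arg| < Real.pi * m / (m + 1) → Polynomial.aeval z f ≠ 0) →
      IsMultiplyPositiveSeq m (fun n => f.coeff n)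

/-- The case `m = 0` of Schoenberg's theorem is trivially true (`PF_0` is no condition), a sanity
check on the packaging. [folklore] -/
theorem schoenberg_sector_pf.case_zero (f : ℝ[X]) :
    IsMultiplyPositiveSeq 0 (fun n => f.coeff n) :=
  isMultiplyPositiveSeq_zero _

/-- The case `m = 1` of Schoenberg's theorem for LINEAR `f = c + αX`, proved: `f(0) = c > 0` and no
zero on the positive real axis (`arg z = 0 < π/2`) force `α ≥ 0`, so the coefficients are `≥ 0`,
i.e. `PF_1`. (Sanity check that the sector hypothesis is stated the right way round.) [folklore] -/
theorem schoenberg_sector_pf.linear_one {c α : ℝ} (hc : 0 < c)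
    (hz : ∀ z : ℂ, |z.arg| < Real.pi * (1 : ℕ) / ((1 : ℕ) + 1) →
      Polynomial.aeval z (Polynomial.C c + Polynomial.C α * X) ≠ 0) :
    IsMultiplyPositiveSeq 1 (fun n => (Polynomial.C c + Polynomial.C α * X).coeff n) := by
  rw [isMultiplyPositiveSeq_one_iff]
  have hα : 0 ≤ α := by
    by_contra hneg
    push Not at hneg
    -- the positive real zero `-c/α`
    have hroot := hz ((-c / α : ℝ) : ℂ) (by
      rw [Complex.arg_ofReal_of_nonneg (div_nonneg_of_nonpos (neg_nonpos.2 hc.le) hneg.le)]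
      simp [Real.pi_pos])
    apply hroot
    simp only [map_add, Polynomial.aeval_C, map_mul, Polynomial.aeval_X, Complex.coe_algebraMap]
    have hα0 : (α : ℂ) ≠ 0 := by exact_mod_cast hneg.ne
    push_cast
    field_simp
    ring
  intro n
  rcases n with _ | _ | n
  · simp [hc.le]
  · simp [hα]
  · simp

end Literature.Analysis.TotalPositivity
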